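import Literature.MathematicalPhysics.QuantumFieldTheory.Balaban1983to89.Node00.RegSetOfFibredChart

/-!
# NODE 00 — THE FIBRED-CHART CRITERION FOR THE MAXIMAL REGULAR SET, SUPPORT FORM: the chart need lie over the coarse variable only WHERE THE JACOBIAN IS
# NON-ZERO (sequel of `Node00.RegSetOfFibredChart`; the hypothesis shape the private-coordinate chart `T4TriangularFibredChart` delivers pointwise)

Cell `pub-ymgap` (YM-PLAN Track A), width seat `pub-ymgap-dag-n09-w6` g3 (D-0149 ∕ R399 width seat 6 of node N09 = [Balaban1987RG1] §§2–5); helper of K1⁷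
`StabilityBAtRecordR13SepCoPH` = stmt-QuantumFields-20542 (`--supports`, count-neutral).  [I] = [Balaban1987RG1].

WHY.  `Node00.RegSetOfFibredChart` (dag-n09-w6 g2, p609712) puts an open coarse set `U` inside the maximal regular set `regSetOfRecord F N K k ρ` of the transform of
record from DISPLAYED fibred-chart data `(Z, τ, Φ, J, S)` of the averaging: `hmap : dU⌊(Ū⁻¹U ∩ S) = Φ_*((dV⌊U ⊗ τ)·J)` and `havgΦ : Ū(Φ(V,z)) = V` for ALL
`V ∈ U` and ALL `z`.  The only use of `havgΦ` there is under the integral against `(dV⌊U ⊗ τ)·J`, where the integrand carries the factor `J(V,z)`: the fibre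
identity is needed ONLY WHERE `J(V,z) ≠ 0`.  A chart built by inverting the averaging in private coordinates (`T4TriangularFibredChart`: `Φ(V,U) = extend β (θ_c(U,V c))_c U`,
`J = 𝟙[good set]·∏ j_c`) satisfies exactly that — `Ū(Φ(V,z)) = V` whenever `J(V,z) ≠ 0` (`apply_triChart_eq_of_jacobian_ne_zero`), with `Φ` junk and `J = 0` off
the good set — and NOT the everywhere form unless a measurable section of `Ū` is spliced in.  THIS FILE re-derives the §2 identity and the §4∕§5 doors of the
prequel under the SUPPORT-FORM hypothesis `havgΦJ : ∀ V ∈ U, ∀ z, J (V, z) ≠ 0 → Ū(Φ(V,z)) = V` (strictly weaker; the prequel's doors are the special case),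
BY NAME over the prequel's §1 doors (`subset_regSetOfRecord_of_forall_integral_eq`, `TcanOfRecord_eqOn_of_forall_integral_eq`, `hasContVersionOn_regSet`).

CONTENTS (8 theorems, 0 def).  §1 ★ `integral_mul_comp_eq_integral_fibreIntegral_mul_of_ne_zero` (the Jacobian face of the push-forward identity, support form).
§2 `hasContVersionOn_transform_of_fibredChart_of_ne_zero`, `subset_regSet_transform_of_fibredChart_of_ne_zero` (any transform in the `IsRT` reading).  §3 at the record:
★ `subset_regSetOfRecord_of_fibredChart_of_ne_zero`, `hasContTransportOn_of_fibredChart_of_ne_zero`, ★ `TcanOfRecord_eqOn_fibreIntegral_of_fibredChart_of_ne_zero`,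
★★ `domAlt_subset_regSetOfRecord_of_fibredChart_of_ne_zero` (the `hreg` binder shape at one `k`), and `havgΦJ_of_havgΦ` (the prequel's hypothesis implies this one).

HONEST FRAMING.  Count-neutral measure theory over the prequel; no chart constructed, no Jacobian computed, continuity of the fibre integral DISPLAYED (`hgc`); nothing of
Bałaban's asserted; `hreg` RE-SHAPED not discharged; N09 NOT discharged; K1⁷ NOT closed; counts unmoved.  One finite four-torus programme at fixed `ε`; R4 closes the conditional
rung `BalabanLadder.UV` only — not ℝ⁴ ∕ infinite volume ∕ OS ∕ mass gap ∕ Clay.  No `sorry`, `axiom`, `def`, `instance`, `notation`.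
-/

noncomputable section

open MeasureTheory Set Filter
open scoped ENNReal NNReal Topology

namespace Literature.MathematicalPhysics.QuantumFieldTheory.Balaban1983to89.Node00

open _root_.Topology _root_.MeasureTheory
open T4Continuum (T4Family)
open B12ContinuousTransportInvarianceOn (isOpen_domAltOfRecord)

/-! ## §1. The Jacobian face of the push-forward identity, support form -/

section FibredChart

variable {α β Z : Type*} [MeasurableSpace α] [MeasurableSpace β] [MeasurableSpace Z]
  {ν : Measure β} {μ : Measure α} {τ : Measure Z} {avg : β → α} {U : Set α} {S : Set β} {Φ : α × Z → β} {J : α × Z → ℝ≥0}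

omit [MeasurableSpace α] [MeasurableSpace β] [MeasurableSpace Z] in
/-- The prequel's everywhere fibre hypothesis implies the support form. [cite: Balaban1987RG1, (2.10) p.267 (bookkeeping)] -/
theorem havgΦJ_of_havgΦ (havgΦ : ∀ V ∈ U, ∀ z, avg (Φ (V, z)) = V) :
    ∀ V ∈ U, ∀ z, J (V, z) ≠ 0 → avg (Φ (V, z)) = V :=
  fun V hV z _ => havgΦ V hV z

/-- ★ **THE JACOBIAN FACE OF THE PUSH-FORWARD IDENTITY, SUPPORT FORM** (`Node00.integral_mul_comp_eq_integral_fibreIntegral_mul` with `havgΦ` asked only where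
`J ≠ 0`): for every bounded measurable test `f` vanishing off the measurable set `U`,
`∫ ρ(x)·f(avg x) dν(x) = ∫ (∫ J(V,z)·ρ(Φ(V,z)) dτ(z))·f(V) dμ(V)`. [cite: Balaban1987RG1, (2.10) p.267 and (0.13) p.254] -/
theorem integral_mul_comp_eq_integral_fibreIntegral_mul_of_ne_zero [SFinite μ] [SFinite τ] (hU : MeasurableSet U) (havg : Measurable avg)
    (hΦ : Measurable Φ) (hJ : Measurable J) (havgΦJ : ∀ V ∈ U, ∀ z, J (V, z) ≠ 0 → avg (Φ (V, z)) = V)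
    (hmap : ν.restrict (avg ⁻¹' U ∩ S) = (((μ.restrict U).prod τ).withDensity (fun p => (J p : ℝ≥0∞))).map Φ)
    {ρ : β → ℝ} (hρ : Integrable ρ ν) (hS : ∀ x, ρ x ≠ 0 → x ∈ S)
    {f : α → ℝ} (hf : Measurable f) (hfC : ∃ C : ℝ, ∀ V, |f V| ≤ C) (hf0 : ∀ V, V ∉ U → f V = 0) :
    ∫ x, ρ x * f (avg x) ∂ν = ∫ V, (∫ z, (J (V, z) : ℝ) * ρ (Φ (V, z)) ∂τ) * f V ∂μ := by
  obtain ⟨C, hC⟩ := hfC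
  -- (a) localise the fine integral to `avg ⁻¹' U ∩ S`
  have hloc : ∫ x, ρ x * f (avg x) ∂ν = ∫ x in avg ⁻¹' U ∩ S, ρ x * f (avg x) ∂ν := by
    refine (setIntegral_eq_integral_of_forall_compl_eq_zero fun x hx => ?_).symm
    by_cases hxU : avg x ∈ U
    · have hxS : x ∉ S := fun h' => hx ⟨hxU, h'⟩
      have : ρ x = 0 := by
        by_contra hne
        exact hxS (hS x hne)
      rw [this, zero_mul]
    · rw [hf0 _ hxU, mul_zero]
  -- (b) change variables along the chart
  have hmeasν : AEStronglyMeasurable (fun x => ρ x * f (avg x)) (ν.restrict (avg ⁻¹' U ∩ S)) :=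
    (hρ.aestronglyMeasurable.mul (hf.comp havg).aestronglyMeasurable).restrict
  have hchange : ∫ x in avg ⁻¹' U ∩ S, ρ x * f (avg x) ∂ν
      = ∫ p, (J p : ℝ) * (ρ (Φ p) * f (avg (Φ p))) ∂((μ.restrict U).prod τ) := by
    rw [hmap] at hmeasν ⊢
    rw [integral_map hΦ.aemeasurable hmeasν, integral_withDensity_eq_integral_smul hJ]
    refine integral_congr_ae (ae_of_all _ fun p => ?_)
    simp only [NNReal.smul_def, smul_eq_mul]
  -- (c) integrability of the chart integrand (with the bounded test factor)
  have hint : Integrable (fun p : α × Z => (J p : ℝ) * (ρ (Φ p) * f (avg (Φ p)))) ((μ.restrict U).prod τ) := by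
    have hb := integrable_jacobian_mul_comp_of_fibredChart hΦ hJ hmap hρ
    have hm : AEStronglyMeasurable (fun p : α × Z => f (avg (Φ p))) ((μ.restrict U).prod τ) :=
      (hf.comp (havg.comp hΦ)).aestronglyMeasurable
    have h' : Integrable (fun p : α × Z => (J p : ℝ) * ρ (Φ p) * f (avg (Φ p))) ((μ.restrict U).prod τ) :=
      hb.mul_bdd (c := C) hm (Filter.Eventually.of_forall fun p => by simpa [Real.norm_eq_abs] using hC (avg (Φ p)))
    exact h'.congr (ae_of_all _ fun p => by ring)
  -- (d) Fubini; on `{J ≠ 0}` the chart lies over `V`, and where `J = 0` both integrands vanish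
  have hfub : ∫ p, (J p : ℝ) * (ρ (Φ p) * f (avg (Φ p))) ∂((μ.restrict U).prod τ)
      = ∫ V, (∫ z, (J (V, z) : ℝ) * ρ (Φ (V, z)) ∂τ) * f V ∂(μ.restrict U) := by
    rw [integral_prod _ hint]
    refine integral_congr_ae ?_
    filter_upwards [ae_restrict_mem hU] with V hV
    rw [← integral_mul_const]
    refine integral_congr_ae (ae_of_all _ fun z => ?_)
    simp only
    by_cases hJz : J (V, z) = 0
    · rw [hJz, NNReal.coe_zero, zero_mul, zero_mul, zero_mul]
    · rw [havgΦJ V hV z hJz]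
      ring
  -- (e) back to the whole coarse space: `f` vanishes off `U`
  have hback : ∫ V, (∫ z, (J (V, z) : ℝ) * ρ (Φ (V, z)) ∂τ) * f V ∂(μ.restrict U)
      = ∫ V, (∫ z, (J (V, z) : ℝ) * ρ (Φ (V, z)) ∂τ) * f V ∂μ :=
    setIntegral_eq_integral_of_forall_compl_eq_zero fun V hV => by rw [hf0 V hV, mul_zero]
  rw [hloc, hchange, hfub, hback]

end FibredChart

/-! ## §2. Any transform in the push-forward reading: continuous version on `U`, `U ⊆ regSet` (support form) -/

section Assembly

variable {α β Z : Type*} [TopologicalSpace α] [MeasurableSpace α] [OpensMeasurableSpace α] [MeasurableSpace β] [MeasurableSpace Z]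
  {ν : Measure β} {μ : Measure α} {τ : Measure Z} [SFinite μ] [SFinite τ]
  {avg : β → α} {U : Set α} {S : Set β} {Φ : α × Z → β} {J : α × Z → ℝ≥0}

/-- **FIBRED CHART (support form) ⇒ CONTINUOUS VERSION ON `U`.** [cite: Balaban1987RG1, (0.13) p.254 and (2.10) p.267] -/
theorem hasContVersionOn_transform_of_fibredChart_of_ne_zero (hU : IsOpen U) (havg : Measurable avg)
    (hΦ : Measurable Φ) (hJ : Measurable J) (havgΦJ : ∀ V ∈ U, ∀ z, J (V, z) ≠ 0 → avg (Φ (V, z)) = V)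
    (hmap : ν.restrict (avg ⁻¹' U ∩ S) = (((μ.restrict U).prod τ).withDensity (fun p => (J p : ℝ≥0∞))).map Φ)
    {ρ : β → ℝ} (hρ : Integrable ρ ν) (hS : ∀ x, ρ x ≠ 0 → x ∈ S) {T : α → ℝ} (hTi : IntegrableOn T U μ)
    (hT : ∀ f : α → ℝ, Measurable f → (∃ C : ℝ, ∀ V, |f V| ≤ C) → ∫ V, T V * f V ∂μ = ∫ x, ρ x * f (avg x) ∂ν)
    (hgc : ContinuousOn (fun V => ∫ z, (J (V, z) : ℝ) * ρ (Φ (V, z)) ∂τ) U) :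
    HasContVersionOn μ T U :=
  hasContVersionOn_of_forall_integral_mul_eq hU.measurableSet hTi (integrableOn_fibreIntegral_of_fibredChart hΦ hJ hmap hρ) hgc
    fun f hf hfC hf0 =>
      (hT f hf hfC).trans
        (integral_mul_comp_eq_integral_fibreIntegral_mul_of_ne_zero hU.measurableSet havg hΦ hJ havgΦJ hmap hρ hS hf hfC hf0)

/-- **FIBRED CHART (support form) ⇒ `U ⊆ regSet μ T`.** [cite: Balaban1987RG1, (0.13) p.254 and (2.10) p.267] -/
theorem subset_regSet_transform_of_fibredChart_of_ne_zero (hU : IsOpen U) (havg : Measurable avg)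
    (hΦ : Measurable Φ) (hJ : Measurable J) (havgΦJ : ∀ V ∈ U, ∀ z, J (V, z) ≠ 0 → avg (Φ (V, z)) = V)
    (hmap : ν.restrict (avg ⁻¹' U ∩ S) = (((μ.restrict U).prod τ).withDensity (fun p => (J p : ℝ≥0∞))).map Φ)
    {ρ : β → ℝ} (hρ : Integrable ρ ν) (hS : ∀ x, ρ x ≠ 0 → x ∈ S) {T : α → ℝ} (hTi : IntegrableOn T U μ)
    (hT : ∀ f : α → ℝ, Measurable f → (∃ C : ℝ, ∀ V, |f V| ≤ C) → ∫ V, T V * f V ∂μ = ∫ x, ρ x * f (avg x) ∂ν)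
    (hgc : ContinuousOn (fun V => ∫ z, (J (V, z) : ℝ) * ρ (Φ (V, z)) ∂τ) U) :
    U ⊆ regSet μ T :=
  subset_regSet hU (hasContVersionOn_transform_of_fibredChart_of_ne_zero hU havg hΦ hJ havgΦJ hmap hρ hS hTi hT hgc)

end Assembly

/-! ## §3. At the record (support form): `U ⊆ regSetOfRecord`, the on-domain proviso, `TcanOfRecord` = the fibre integral on `U`, the `hreg` shape -/

section Record

variable {F : T4Family} {N : ℕ} [NeZero N] {Z : Type*} [MeasurableSpace Z] {τ : Measure Z} [SFinite τ]

/-- ★ **THE JACOBIAN FACE AT THE RECORD, SUPPORT FORM: a fibred chart of `avOfRecord F N K k` over `U` whose fibre identity holds where `J ≠ 0` ⇒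
`U ⊆ regSetOfRecord F N K k ρ`.** [cite: Balaban1987RG1, (2.10) p.267, (0.13) p.254 and p.259] -/
theorem subset_regSetOfRecord_of_fibredChart_of_ne_zero {K k : ℕ} (hk : k < K) {ρ : Density (F.P K) k (SU N)}
    (hρ : Integrable ρ (fieldMeasure (F.P K) k (SU N))) {U : Set (PBond (F.P K) (k + 1) → SU N)} (hU : IsOpen U)
    {S : Set (GaugeField (F.P K) k (SU N))} (hS : ∀ x, ρ x ≠ 0 → x ∈ S)
    {Φ : (PBond (F.P K) (k + 1) → SU N) × Z → GaugeField (F.P K) k (SU N)} {J : (PBond (F.P K) (k + 1) → SU N) × Z → ℝ≥0}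
    (hΦ : Measurable Φ) (hJ : Measurable J) (havgΦJ : ∀ V ∈ U, ∀ z, J (V, z) ≠ 0 → (avOfRecord F N K k).avg (Φ (V, z)) = V)
    (hmap : (fieldMeasure (F.P K) k (SU N)).restrict ((avOfRecord F N K k).avg ⁻¹' U ∩ S)
      = ((((piHaar (F.P K) (k + 1) (SU N)).restrict U).prod τ).withDensity (fun p => (J p : ℝ≥0∞))).map Φ)
    (hgc : ContinuousOn (fun V => ∫ z, (J (V, z) : ℝ) * ρ (Φ (V, z)) ∂τ) U) :
    U ⊆ regSetOfRecord F N K k ρ := by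
  haveI : IsFiniteMeasure (piHaar (F.P K) (k + 1) (SU N)) :=
    inferInstanceAs (IsFiniteMeasure (fieldMeasure (F.P K) (k + 1) (SU N)))
  refine subset_regSetOfRecord_of_forall_integral_eq hk hρ hU hgc fun f hf hfC hf0 => ?_
  exact integral_mul_comp_eq_integral_fibreIntegral_mul_of_ne_zero hU.measurableSet (avOfRecord_measurable F N K k) hΦ hJ havgΦJ hmap hρ hS
    hf hfC hf0

/-- **… ⇒ the on-domain proviso `HasContTransportOn F N K k ρ U`** (support form). [cite: Balaban1987RG1, (2.10) p.267 and p.259] -/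
theorem hasContTransportOn_of_fibredChart_of_ne_zero {K k : ℕ} (hk : k < K) {ρ : Density (F.P K) k (SU N)}
    (hρ : Integrable ρ (fieldMeasure (F.P K) k (SU N))) {U : Set (PBond (F.P K) (k + 1) → SU N)} (hU : IsOpen U)
    {S : Set (GaugeField (F.P K) k (SU N))} (hS : ∀ x, ρ x ≠ 0 → x ∈ S)
    {Φ : (PBond (F.P K) (k + 1) → SU N) × Z → GaugeField (F.P K) k (SU N)} {J : (PBond (F.P K) (k + 1) → SU N) × Z → ℝ≥0}
    (hΦ : Measurable Φ) (hJ : Measurable J) (havgΦJ : ∀ V ∈ U, ∀ z, J (V, z) ≠ 0 → (avOfRecord F N K k).avg (Φ (V, z)) = V)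
    (hmap : (fieldMeasure (F.P K) k (SU N)).restrict ((avOfRecord F N K k).avg ⁻¹' U ∩ S)
      = ((((piHaar (F.P K) (k + 1) (SU N)).restrict U).prod τ).withDensity (fun p => (J p : ℝ≥0∞))).map Φ)
    (hgc : ContinuousOn (fun V => ∫ z, (J (V, z) : ℝ) * ρ (Φ (V, z)) ∂τ) U) :
    HasContTransportOn F N K k ρ U :=
  haveI := isOpenPosMeasure_piHaar_SUN N (F.P K) (k + 1)
  hasContVersionOn_regSet.mono (subset_regSetOfRecord_of_fibredChart_of_ne_zero hk hρ hU hS hΦ hJ havgΦJ hmap hgc)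

/-- ★ **… ⇒ `TcanOfRecord F N K k ρ` IS THE FIBRE INTEGRAL at every point of `U`** (support form). [cite: Balaban1987RG1, (2.10) p.267 and (0.19) p.255] -/
theorem TcanOfRecord_eqOn_fibreIntegral_of_fibredChart_of_ne_zero {K k : ℕ} (hk : k < K) {ρ : Density (F.P K) k (SU N)}
    (hρ : Integrable ρ (fieldMeasure (F.P K) k (SU N))) {U : Set (PBond (F.P K) (k + 1) → SU N)} (hU : IsOpen U)
    {S : Set (GaugeField (F.P K) k (SU N))} (hS : ∀ x, ρ x ≠ 0 → x ∈ S)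
    {Φ : (PBond (F.P K) (k + 1) → SU N) × Z → GaugeField (F.P K) k (SU N)} {J : (PBond (F.P K) (k + 1) → SU N) × Z → ℝ≥0}
    (hΦ : Measurable Φ) (hJ : Measurable J) (havgΦJ : ∀ V ∈ U, ∀ z, J (V, z) ≠ 0 → (avOfRecord F N K k).avg (Φ (V, z)) = V)
    (hmap : (fieldMeasure (F.P K) k (SU N)).restrict ((avOfRecord F N K k).avg ⁻¹' U ∩ S)
      = ((((piHaar (F.P K) (k + 1) (SU N)).restrict U).prod τ).withDensity (fun p => (J p : ℝ≥0∞))).map Φ)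
    (hgc : ContinuousOn (fun V => ∫ z, (J (V, z) : ℝ) * ρ (Φ (V, z)) ∂τ) U) :
    EqOn (TcanOfRecord F N K k ρ) (fun V => ∫ z, (J (V, z) : ℝ) * ρ (Φ (V, z)) ∂τ) U := by
  haveI : IsFiniteMeasure (piHaar (F.P K) (k + 1) (SU N)) :=
    inferInstanceAs (IsFiniteMeasure (fieldMeasure (F.P K) (k + 1) (SU N)))
  refine TcanOfRecord_eqOn_of_forall_integral_eq hk hρ hU hgc fun f hf hfC hf0 => ?_
  exact integral_mul_comp_eq_integral_fibreIntegral_mul_of_ne_zero hU.measurableSet (avOfRecord_measurable F N K k) hΦ hJ havgΦJ hmap hρ hS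
    hf hfC hf0

/-- ★★ **THE `hreg` BINDER SHAPE, SUPPORT FORM.**  At `U :=` the record's small-field domain of the NEXT step `domAltOfRecord ν K (k+1)`: a fibred chart of
`avOfRecord F N K k` over it on the support of the integrable density `ρ`, lying over the coarse variable wherever its Jacobian is non-zero, with the fibre integral
continuous there, gives `domAltOfRecord F N ν K (k+1) ⊆ regSetOfRecord F N K k ρ` — the displayed `hreg` of N09's Theorem-3 doors at one `k`.  RE-SHAPED, NOT
DISCHARGED: the chart and the continuity stay displayed. [cite: Balaban1987RG1, p.259, (2.10) p.267 and (0.13) p.254] -/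
theorem domAlt_subset_regSetOfRecord_of_fibredChart_of_ne_zero (ν : Stage7Numerics) {K k : ℕ} (hk : k < K) {ρ : Density (F.P K) k (SU N)}
    (hρ : Integrable ρ (fieldMeasure (F.P K) k (SU N)))
    {S : Set (GaugeField (F.P K) k (SU N))} (hS : ∀ x, ρ x ≠ 0 → x ∈ S)
    {Φ : (PBond (F.P K) (k + 1) → SU N) × Z → GaugeField (F.P K) k (SU N)} {J : (PBond (F.P K) (k + 1) → SU N) × Z → ℝ≥0}
    (hΦ : Measurable Φ) (hJ : Measurable J)
    (havgΦJ : ∀ V ∈ domAltOfRecord F N ν K (k + 1), ∀ z, J (V, z) ≠ 0 → (avOfRecord F N K k).avg (Φ (V, z)) = V)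
    (hmap : (fieldMeasure (F.P K) k (SU N)).restrict ((avOfRecord F N K k).avg ⁻¹' domAltOfRecord F N ν K (k + 1) ∩ S)
      = ((((piHaar (F.P K) (k + 1) (SU N)).restrict (domAltOfRecord F N ν K (k + 1))).prod τ).withDensity
          (fun p => (J p : ℝ≥0∞))).map Φ)
    (hgc : ContinuousOn (fun V => ∫ z, (J (V, z) : ℝ) * ρ (Φ (V, z)) ∂τ) (domAltOfRecord F N ν K (k + 1))) :
    domAltOfRecord F N ν K (k + 1) ⊆ regSetOfRecord F N K k ρ :=
  subset_regSetOfRecord_of_fibredChart_of_ne_zero hk hρ (isOpen_domAltOfRecord ν K (k + 1)) hS hΦ hJ havgΦJ hmap hgc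

end Record

end Literature.MathematicalPhysics.QuantumFieldTheory.Balaban1983to89.Node00

end
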